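import Summits.ABC.IUTFork.LDHGenuinePerImageAllLevels
import HarnessLib

/-!
# The fork at [IUTchIII] Corollary 3.12, L-DH level, READING (P): at EVERY rational datum the per-image Corollary AS TYPED holds
# at EVERY prime level `l ∤ den j(λ)` with `l⁵ ≥ den j(λ)` — the (P) binder is COFINITELY TRUE in `l` at each `λ ∈ ℚ`
# (abc-iut cell, branch C, row «C:PERIMAGE-P-ALL-LEVELS», file 4: the general rational datum)

Record-only PROOF file (D-0012) of the abc-iut cell (branch-C certificate seat abc-iut-C-cert-2, gen 6; crux ThetaPartII =
stmt-ABC-19678). TAKES NO SIDE on [IUTchIII] Cor. 3.12 (S. Mochizuki, *Inter-universal Teichmüller theory III*, Cor. 3.12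
p. 173–174) or on any author. Files 1–3 (`LDHGenuinePerImageAllLevels{,B,C}`, p495862 / p496464 / p496479) ran the closed form
`cor312PerImageOf_ratPoint_sharp_closedForm` of abc-iut-c312-d1's sharpened rational-point test (p484321) on the five tabulated
triples. HERE the same closed form is read at an ARBITRARY rational `λ ∉ {0, 1}`:

* §1 **`cor312PerImageOf_ratPoint_of_log_le`** — with the pole dictionary `j(λ) = N/∏_{p∈I} p^{e_p}` and a prime `l ≥ 7`, `l ∉ I`:
  `Σ_{p∈I odd} e_p·log p ≤ (36/7)·Σ_{p∈I odd} log p + 3·log 2 + 5·log l + 6·log π ⟹ ∀ T, T.Cor312PerImageOf` (the closed form with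
  `c = 1`, `1 − 1/l ≥ 6/7`, `1 − 1/(l−1) ≥ 5/6`); in multiplicative words `q_odd ≤ 8·π⁶·rad_odd^{36/7}·l⁵`, `q_odd`/`rad_odd` the odd parts of
  the reduced denominator of `j(λ)` and of its radical.
* §2 **`exists_jInv_dictionary`** — every `λ ∈ ℚ ∖ {0, 1}` HAS a pole dictionary: `j(λ) > 0`, `N = num`, `D = den`, `I` = the prime
  factors of `den`, `e` = its factorisation (Mathlib `Nat.factorization`, `Rat.reduced`).
* §3 **`cor312PerImageOf_ratPoint_of_den_le_pow`** — DICTIONARY-FREE: for `λ ∈ ℚ ∖ {0,1}` and a prime `l ≥ 7` with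
  `l ∤ den j(λ)` and `den j(λ) ≤ l⁵`, `T.Cor312PerImageOf` for EVERY genuine Θ-volume datum `T` of `(λ, l)`; and
  **`cor312PerImageOf_ratPoint_eventually`** — `∃ L, ∀ prime l ≥ L, ∀ T, T.Cor312PerImageOf` (take `L = max(7, den j(λ) + 1)`:
  beyond `den` the level neither divides it nor lies below its fifth root).

READING (neutral; branch-C books): the reading-(P) number-level binders (`hNumPOffBad` of
`Conditional.abc_of_slotLicence_orNumP_K_szpiroBad_read`, p462946, and its M twin) conclude `T.Cor312PerImageOf`; at EVERY rational
`λ` that conclusion is TRUE at all but finitely many prime levels — explicitly at every `l ∤ den j(λ)` with `l⁵ ≥ den j(λ)`, and (§1)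
already at `l⁵ ≥ q_odd/(8π⁶·rad_odd^{36/7})` — so at rational points the binders carry content only on the finite window below that
level; no certificate's hypothesis count moves; nothing is said about points of degree `≥ 2`. HONEST SCOPE: OUR typed per-image
inequality, whose (Ind2) is the cell's full lattice-automorphism typing (Dupuy–Hilado §4.9) — nothing about print's (Ind2), the
printed inequality, or print's choice of `l` ([IUTchIV] Cor. 2.2 takes `l` of the order of the height, far below `den^{1/5}`);
nothing asserts that genuine data exist at any `(λ, l)`, Cor. 3.12 in general, or abc; proved-as-typed ≠ in print; typed ≠ proved.
[cite: Mochizuki2012, IUTchIII Cor. 3.12 p. 173–174, proof Step (x) p. 181; IUTchIV Thm. 1.10 p. 22–24, Step (v) p. 27–29, Cor. 2.2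
(ii) proof (P5) p. 46] [cite: SilvermanAEC2009, Prop. III.1.7(b)] [cite: DupuyHilado2025, §4.9, §4.12] [claim: Mochizuki2012,
status: disputed] for every IUT quotation. PROOF-ONLY: no definitions, no new `Prop`.
-/

noncomputable section

namespace Literature.IUT.LogVolume.Cor22

open NumberField IsDedekindDomain Ideal Module Literature.NumberTheory.DiophantineGeometry
open Literature.NumberTheory.DiophantineGeometry.GenEll Summit.ABC.IUTFork Literature.IUT.HodgeTheaters

variable {q : ℚ} {l N D : ℕ} {I : Finset ℕ} {e : ℕ → ℕ}

/-! ## §1. The closed form with `c = 1` at a prime `l ∉ I`: one inequality, logarithmic in `l` -/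

/-- **READING (P) at a rational datum, every prime `l ∉ I` above an explicit logarithmic threshold.** With the pole dictionary of
`j(q)` and a prime `l ≥ 7` outside `I`: if `Σ_{p∈I∖{2}} e_p·log p ≤ (36/7)·Σ_{p∈I∖{2}} log p + 3·log 2 + 5·log l + 6·log π` then
`T.Cor312PerImageOf` for every genuine Θ-volume datum `T` of `(q, l)` (`cor312PerImageOf_ratPoint_sharp_closedForm` with `c = 1`,
`1 − 1/l ≥ 6/7`, `1 − 1/(l−1) ≥ 5/6`, the `[3∉I]`, `[5∉I]` terms dropped). [cite: Mochizuki2012, IUTchIII Cor. 3.12 p. 173–174; IUTchIV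
Thm. 1.10 Step (v) p. 27–29] [claim: Mochizuki2012, status: disputed] -/
theorem cor312PerImageOf_ratPoint_of_log_le (hq0 : q ≠ 0) (hq1 : q ≠ 1) (hl : l.Prime) (h7 : 7 ≤ l)
    (hI : ∀ p ∈ I, p.Prime) (he : ∀ p ∈ I, e p ≠ 0) (hD : D = ∏ p ∈ I, p ^ e p)
    (hj : jInv q = (N : ℚ) / (D : ℚ)) (hN : N ≠ 0) (hcop : ∀ p ∈ I, ¬ p ∣ N) (hlI : l ∉ I)
    (hcond : ∑ p ∈ I.erase 2, (e p : ℝ) * Real.log p ≤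
      36 / 7 * ∑ p ∈ I.erase 2, Real.log p + 3 * Real.log 2 + 5 * Real.log l + 6 * Real.log Real.pi)
    (T : ThetaVolumeDatumAt (ratPoint q) l) : T.Cor312PerImageOf := by
  have hl7 : (7 : ℝ) ≤ l := by exact_mod_cast h7
  have hR0 : 0 ≤ ∑ p ∈ I.erase 2, Real.log (p : ℝ) :=
    Finset.sum_nonneg fun p hp => Real.log_nonneg (by exact_mod_cast (hI p (Finset.mem_of_mem_erase hp)).one_lt.le)
  refine cor312PerImageOf_ratPoint_sharp_closedForm hq0 hq1 hl h7 hI he hD hj hN hcop le_rfl le_rfl 1 Nat.one_pos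
    (fun p hp _ => Nat.succ_le_of_lt (Nat.lcm_pos (Nat.div_pos (Nat.le_of_dvd (by norm_num) (Nat.gcd_dvd_left 30 (e p)))
      (Nat.gcd_pos_of_pos_left _ (by norm_num))) (by split_ifs <;> norm_num))) ?_ T
  rw [if_neg hlI, if_neg hlI, sub_zero, sub_zero, Nat.cast_one, one_mul]
  have hX3 : (0 : ℝ) ≤ (if 3 ∈ I then (0 : ℝ) else 2⁻¹ * Real.log 3) := by
    split_ifs
    · exact le_rfl
    · exact mul_nonneg (by norm_num) (Real.log_nonneg (by norm_num))
  have hX5 : (0 : ℝ) ≤ (if 5 ∈ I then (0 : ℝ) else (3 / 4 : ℝ) * Real.log 5) := by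
    split_ifs
    · exact le_rfl
    · exact mul_nonneg (by norm_num) (Real.log_nonneg (by norm_num))
  have hlog7 : 0 < Real.log l := Real.log_pos (by linarith)
  have h1 : 1 / (l : ℝ) ≤ 1 / 7 := one_div_le_one_div_of_le (by norm_num) hl7
  have h2 : 1 / ((l : ℝ) - 1) ≤ 1 / 6 := one_div_le_one_div_of_le (by norm_num) (by linarith)
  have h3 : 6 / 7 * ∑ p ∈ I.erase 2, Real.log (p : ℝ) ≤ (1 - 1 / (l : ℝ)) * ∑ p ∈ I.erase 2, Real.log (p : ℝ) :=
    mul_le_mul_of_nonneg_right (by linarith) hR0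
  have h4 : 5 / 6 * Real.log l ≤ (1 - 1 / ((l : ℝ) - 1)) * Real.log l :=
    mul_le_mul_of_nonneg_right (by linarith) hlog7.le
  linarith

/-! ## §2. Every `λ ∈ ℚ ∖ {0,1}` has a pole dictionary -/

/-- `j(λ) > 0` on `ℚ ∖ {0, 1}`: `j(λ) = 2⁸(λ² − λ + 1)³/(λ²(λ−1)²)` with `λ² − λ + 1 = (λ − ½)² + ¾ > 0`.
[cite: SilvermanAEC2009, Prop. III.1.7(b)] -/
theorem jInv_pos_of_ne (hq0 : q ≠ 0) (hq1 : q ≠ 1) : 0 < jInv q := by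
  unfold jInv
  have h1 : 0 < q ^ 2 - q + 1 := by nlinarith [sq_nonneg (2 * q - 1)]
  have h2 : 0 < q ^ 2 := by positivity
  have h3 : 0 < (q - 1) ^ 2 := by
    have h := sub_ne_zero.2 hq1
    positivity
  positivity

/-- **Every rational `λ ∉ {0, 1}` has a pole dictionary**: `j(λ) = N/D` with `N = num j(λ) ≠ 0`, `D = den j(λ) = ∏_{p ∈ I} p^{e_p}` over
`I` = the prime factors of `D`, `e_p = v_p(D) ≥ 1`, and `p ∤ N` for `p ∈ I` (`Rat.reduced`). [folklore] -/
theorem exists_jInv_dictionary (hq0 : q ≠ 0) (hq1 : q ≠ 1) :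
    ∃ (N : ℕ) (I : Finset ℕ) (e : ℕ → ℕ), (∀ p ∈ I, p.Prime) ∧ (∀ p ∈ I, e p ≠ 0) ∧
      (jInv q).den = ∏ p ∈ I, p ^ e p ∧ jInv q = (N : ℚ) / ((jInv q).den : ℚ) ∧ N ≠ 0 ∧ (∀ p ∈ I, ¬ p ∣ N) ∧
      (∀ p ∈ I, p ∣ (jInv q).den) := by
  set j := jInv q with hjdef
  have hjpos : 0 < j := jInv_pos_of_ne hq0 hq1
  have hnum : 0 < j.num := Rat.num_pos.2 hjpos
  have hden : j.den ≠ 0 := j.den_nz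
  refine ⟨j.num.natAbs, j.den.primeFactors, fun p => j.den.factorization p, fun p hp => Nat.prime_of_mem_primeFactors hp,
    fun p hp => ?_, ?_, ?_, ?_, fun p hp => ?_, fun p hp => Nat.dvd_of_mem_primeFactors hp⟩
  · exact (Nat.Prime.factorization_pos_of_dvd (Nat.prime_of_mem_primeFactors hp) hden (Nat.dvd_of_mem_primeFactors hp)).ne'
  · conv_lhs => rw [← Nat.prod_factorization_pow_eq_self hden]
    rw [Finsupp.prod, Nat.support_factorization]
  · have hcast : ((j.num.natAbs : ℕ) : ℚ) = (j.num : ℚ) := by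
      rw [Nat.cast_natAbs, Int.cast_abs, abs_of_pos (by exact_mod_cast hnum)]
    rw [hcast, Rat.num_div_den]
  · exact Int.natAbs_ne_zero.2 hnum.ne'
  · intro hpN
    have h1 : p ∣ Nat.gcd j.num.natAbs j.den := Nat.dvd_gcd hpN (Nat.dvd_of_mem_primeFactors hp)
    rw [Nat.Coprime.gcd_eq_one j.reduced, Nat.dvd_one] at h1
    exact (Nat.prime_of_mem_primeFactors hp).ne_one h1

/-! ## §3. Dictionary-free statements at an arbitrary rational datum -/

/-- **READING (P) AT EVERY RATIONAL DATUM, EVERY PRIME LEVEL `l ∤ den j(λ)` WITH `l⁵ ≥ den j(λ)`**: for `λ ∈ ℚ ∖ {0,1}` and a prime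
`l ≥ 7` with `l ∤ den j(λ)` and `den j(λ) ≤ l⁵`, `T.Cor312PerImageOf` for EVERY genuine Θ-volume datum `T` of `(λ, l)` — NO other
hypothesis (`Σ_{p odd} e_p log p ≤ log den ≤ 5 log l` feeds §1). [cite: Mochizuki2012, IUTchIII Cor. 3.12 p. 173–174; IUTchIV Thm. 1.10
Step (v) p. 27–29, Cor. 2.2 (ii) proof (P5) p. 46] [claim: Mochizuki2012, status: disputed] -/
theorem cor312PerImageOf_ratPoint_of_den_le_pow (hq0 : q ≠ 0) (hq1 : q ≠ 1) (hl : l.Prime) (h7 : 7 ≤ l)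
    (hdvd : ¬ l ∣ (jInv q).den) (hden : (jInv q).den ≤ l ^ 5)
    (T : ThetaVolumeDatumAt (ratPoint q) l) : T.Cor312PerImageOf := by
  obtain ⟨N, I, e, hI, he, hD, hj, hN, hcop, hdvdI⟩ := exists_jInv_dictionary hq0 hq1
  have hlI : l ∉ I := fun h => hdvd (hdvdI l h)
  have hl1 : (1 : ℝ) < l := by exact_mod_cast (show 1 < l by omega)
  refine cor312PerImageOf_ratPoint_of_log_le hq0 hq1 hl h7 hI he hD hj hN hcop hlI ?_ T
  -- `Σ_{I∖2} e_p log p ≤ Σ_I e_p log p = log D ≤ 5 log l`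
  have hterm : ∀ p ∈ I, 0 ≤ (e p : ℝ) * Real.log p := fun p hp =>
    mul_nonneg (Nat.cast_nonneg _) (Real.log_nonneg (by exact_mod_cast (hI p hp).one_lt.le))
  have h1 : ∑ p ∈ I.erase 2, (e p : ℝ) * Real.log p ≤ ∑ p ∈ I, (e p : ℝ) * Real.log p :=
    Finset.sum_le_sum_of_subset_of_nonneg (Finset.erase_subset 2 I) fun p hp _ => hterm p hp
  have h2 : ∑ p ∈ I, (e p : ℝ) * Real.log p = Real.log ((jInv q).den : ℝ) := by
    rw [hD, Nat.cast_prod, Real.log_prod]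
    · refine Finset.sum_congr rfl fun p hp => ?_
      rw [Nat.cast_pow, Real.log_pow]
    · intro p hp
      exact_mod_cast pow_ne_zero _ (hI p hp).ne_zero
  have h3 : Real.log ((jInv q).den : ℝ) ≤ 5 * Real.log l := by
    have h := Real.log_le_log (by exact_mod_cast Nat.pos_of_ne_zero (jInv q).den_nz)
      (show ((jInv q).den : ℝ) ≤ (l : ℝ) ^ 5 by exact_mod_cast hden)
    rwa [Real.log_pow, Nat.cast_ofNat] at h
  have hR0 : 0 ≤ ∑ p ∈ I.erase 2, Real.log (p : ℝ) :=
    Finset.sum_nonneg fun p hp => Real.log_nonneg (by exact_mod_cast (hI p (Finset.mem_of_mem_erase hp)).one_lt.le)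
  have hp2 : 0 < Real.log 2 := Real.log_pos (by norm_num)
  have hpi : 0 < Real.log Real.pi := Real.log_pos (by linarith [Real.pi_gt_three])
  linarith

/-- **COFINITENESS IN `l` AT EVERY RATIONAL DATUM**: for `λ ∈ ℚ ∖ {0,1}` there is an explicit `L` (`= max(7, den j(λ) + 1)`) such
that for EVERY prime `l ≥ L` and EVERY genuine Θ-volume datum `T` of `(λ, l)`, `T.Cor312PerImageOf` — reading (P)'s per-image
Corollary AS TYPED is true at all but finitely many levels of every rational point. [cite: Mochizuki2012, IUTchIII Cor. 3.12
p. 173–174] [claim: Mochizuki2012, status: disputed] -/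
theorem cor312PerImageOf_ratPoint_eventually (hq0 : q ≠ 0) (hq1 : q ≠ 1) :
    ∃ L : ℕ, ∀ l : ℕ, l.Prime → L ≤ l → ∀ T : ThetaVolumeDatumAt (ratPoint q) l, T.Cor312PerImageOf := by
  refine ⟨max 7 ((jInv q).den + 1), fun l hl hL T => ?_⟩
  have h7 : 7 ≤ l := le_trans (le_max_left _ _) hL
  have hdl : (jInv q).den < l := Nat.lt_of_lt_of_le (Nat.lt_succ_self _) (le_trans (le_max_right _ _) hL)
  refine cor312PerImageOf_ratPoint_of_den_le_pow hq0 hq1 hl h7 (fun h => ?_) ?_ T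
  · exact absurd (Nat.le_of_dvd (Nat.pos_of_ne_zero (jInv q).den_nz) h) (not_le.2 hdl)
  · calc (jInv q).den ≤ l := hdl.le
      _ = l ^ 1 := (pow_one l).symm
      _ ≤ l ^ 5 := Nat.pow_le_pow_right hl.pos (by norm_num)

end Literature.IUT.LogVolume.Cor22

end
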